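import Mathlib.AlgebraicGeometry.EllipticCurve.LFunction
import Literature.NumberTheory.EllipticCurves.AnalyticRank
import Literature.NumberTheory.EllipticCurves.RootNumberProofs
import Literature.NumberTheory.EllipticCurves.MinimalModelReduction
import Literature.NumberTheory.DiophantineGeometry.LocalReductionProofs
import Literature.NumberTheory.DiophantineGeometry.MinimalModelUniquenessProofs
import HarnessLib

/-!
# Isomorphism invariance of the `L`-function of an elliptic curve — discharged facts

Trunk T-ELLARITH / `EllArithM` (companion proof file; theorems only).

For a Weierstrass equation `W` of an *elliptic* curve over a number field `K` and an admissible
change of variables `C : VariableChange K`, Mathlib's formal `L`-function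
`WeierstrassCurve.LFunction` (Euler product over the finite places `𝔭` of the local Euler factors
`WeierstrassCurve.localEulerFactor O_𝔭 (W / K_𝔭)`, each computed on the chosen minimal model
`WeierstrassCurve.minimal`) is unchanged under `W ↦ C • W` (`WeierstrassCurve.LFunction_smul`), and
hence so are `LSeries`, the entire continuation `entireLFunction`, the analytic rank, the leading
Taylor coefficient and the completed `L`-function of `Literature…AnalyticRank`.

Silverman, *The Arithmetic of Elliptic Curves* (2nd ed. 2009): the `L`-series of `E/K` is defined
(App. C §16, PDF pp. 390–391) from the reduction types and the numbers of points `#Ẽ_v(k_v)` of the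
reductions of minimal models at the finite places; these are isomorphism invariants because the
minimal Weierstrass equation at `v` is unique up to a change of coordinates with `u ∈ R*`,
`r, s, t ∈ R` (Prop. VII.1.3(b), PDF p. 165), which reduces to an isomorphism of the reduced
curves over the residue field (VII.2, PDF p. 166) and preserves the reduction type
(Prop. VII.5.1, PDF p. 174; split/non-split: the tangent directions at the node correspond).

## Contents

* `natCard_point_reduction_eq_of_isMinimal_of_eq_smul`: two `K`-isomorphic minimal equations of an
  elliptic curve over the fraction field of a DVR have reductions with the same number of points
  (`exists_reduction_eq_smul`, AEC VII.1.3(b) and VII.2, with `natCard_point_smul` of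
  `Literature…MinimalModelReduction`). The reduction type (good / multiplicative / split
  multiplicative) is likewise invariant (`hasGoodReduction_iff_of_isMinimal_of_eq_smul`,
  `hasMultiplicativeReduction_iff_of_isMinimal_of_eq_smul`,
  `hasSplitMultiplicativeReduction_iff_of_isMinimal_of_eq_smul` of `RootNumberProofs` /
  `LocalReductionProofs`).
* `localPolynomial_smul`, `localEulerFactor_smul` (over the fraction field of any DVR),
  `LFunction_smul`, `LSeries_smul`, `entireContinuations_smul`, `hasEntireLFunction_smul_iff`,
  `entireLFunction_smul`, `analyticRank_smul`, `leadingLCoeff_smul`, `completedLFunction_smul`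
  (over a number field).

## References

* J. H. Silverman, *The Arithmetic of Elliptic Curves*, GTM 106, 2nd ed. 2009: Prop. VII.1.3(b)
  (PDF p. 165), VII.2 (PDF p. 166), Prop. VII.5.1 (PDF p. 174), App. C §16 (PDF pp. 390–391:
  definition of `L_v(T)`, `a_v = q_v + 1 − #Ẽ_v(k_v)`, `L_{E/K}(s) = ∏_v L_v(q_v^{-s})^{-1}`).
-/

open Polynomial

namespace WeierstrassCurve

/-! ### Local invariance for `K`-isomorphic minimal equations -/

section LocalInvariance

variable (R : Type*) [CommRing R] [IsDomain R] [IsDiscreteValuationRing R]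
  {K : Type*} [Field K] [Algebra R K] [IsFractionRing R K]

open IsLocalRing

/-- Two `K`-isomorphic minimal Weierstrass equations of an elliptic curve (`Δ ≠ 0`) have
reductions with the same number of points: the reductions are isomorphic over the residue field
(`exists_reduction_eq_smul`, AEC VII.2) and a change of variables is a bijection on points
(`natCard_point_smul`). [cite: SilvermanAEC2009, VII.2 (PDF p. 166) and Prop. VII.1.3(b)] -/
theorem natCard_point_reduction_eq_of_isMinimal_of_eq_smul {W₁ W₂ : WeierstrassCurve K}
    [IsMinimal R W₁] [IsMinimal R W₂] {D : VariableChange K} (h : W₂ = D • W₁) (hΔ : W₁.Δ ≠ 0) :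
    Nat.card (W₂.reduction R).toAffine.Point = Nat.card (W₁.reduction R).toAffine.Point := by
  obtain ⟨E, hE⟩ := exists_reduction_eq_smul R h hΔ
  rw [hE]
  exact natCard_point_smul _ _

/-- The chosen minimal models of `W` and `C • W` differ by a change of variables over `K`.
[folklore] -/
theorem exists_minimal_smul_eq (W : WeierstrassCurve K) (C : VariableChange K) :
    ∃ D : VariableChange K, (C • W).minimal R = D • W.minimal R :=
  ⟨((C • W).exists_isMinimal R).choose * C * ((W.exists_isMinimal R).choose)⁻¹, by
    rw [minimal, minimal, mul_smul, mul_smul, inv_smul_smul]⟩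

/-- The chosen minimal model of an elliptic curve is an elliptic curve. Stated as a theorem (used
via `haveI`) to keep this file free of definitions. [folklore] -/
theorem isElliptic_minimal (W : WeierstrassCurve K) [W.IsElliptic] : (W.minimal R).IsElliptic := by
  rw [minimal]; infer_instance

/-- **The local polynomial is an isomorphism invariant** of an elliptic curve over the fraction
field of a DVR: Mathlib's `WeierstrassCurve.localPolynomial` (`1 − a T + q T²`, `1 ∓ T`, `1`
according to the reduction type of the chosen minimal model, `a = q + 1 − #Ẽ(k)`) agrees on `W`
and `C • W`, since their minimal models are `K`-isomorphic minimal equations of an elliptic curve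
and reduction type and point count of the reduction are invariants of such
(Silverman, AEC VII.5, Prop. 5.1 and VII.2 with VII.1.3(b); App. C §16 for the local factor).
[cite: SilvermanAEC2009, App. C §16 (PDF pp. 390–391) with VII.1 Prop. 1.3(b)] -/
theorem localPolynomial_smul (W : WeierstrassCurve K) [W.IsElliptic] (C : VariableChange K) :
    (C • W).localPolynomial R = W.localPolynomial R := by
  obtain ⟨D, hD⟩ := exists_minimal_smul_eq R W C
  haveI := isElliptic_minimal R W
  have hΔ : (W.minimal R).Δ ≠ 0 := (W.minimal R).isUnit_Δ.ne_zero
  classical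
  unfold localPolynomial
  simp only [hasGoodReduction_iff_of_isMinimal_of_eq_smul R hD,
    hasSplitMultiplicativeReduction_iff_of_isMinimal_of_eq_smul R hD hΔ,
    hasMultiplicativeReduction_iff_of_isMinimal_of_eq_smul R hD hΔ,
    natCard_point_reduction_eq_of_isMinimal_of_eq_smul R hD hΔ]

/-- The local Euler factor (Mathlib's `WeierstrassCurve.localEulerFactor`) is an isomorphism
invariant of an elliptic curve over the fraction field of a DVR (from `localPolynomial_smul`).
[cite: SilvermanAEC2009, App. C §16 (PDF pp. 390–391) with VII.1 Prop. 1.3(b)] -/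
theorem localEulerFactor_smul (W : WeierstrassCurve K) [W.IsElliptic] (C : VariableChange K) :
    (C • W).localEulerFactor R = W.localEulerFactor R := by
  simp only [localEulerFactor, localPowerSeries, localPolynomial_smul]

end LocalInvariance

/-! ### Global invariance over a number field -/

section NumberField

variable {K : Type*} [Field K] [NumberField K] (W : WeierstrassCurve K) [W.IsElliptic]
  (C : VariableChange K)

open IsDedekindDomain NumberField

/-- **The `L`-function of an elliptic curve over a number field is an isomorphism invariant**:
Mathlib's formal Dirichlet series `WeierstrassCurve.LFunction` (Euler product of the local factors
of `W / K_𝔭` over `O_𝔭`) agrees on `W` and `C • W`, place by place (`localEulerFactor_smul`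
applied to `W / K_𝔭` and `C / K_𝔭`). Silverman, AEC App. C §16 with Prop. VII.1.3(b).
[cite: SilvermanAEC2009, App. C §16 (PDF pp. 390–391) with VII.1 Prop. 1.3(b)] -/
theorem LFunction_smul : (C • W).LFunction = W.LFunction := by
  unfold LFunction
  congr 1
  funext p
  simp only [baseChange, ← map_variableChange]
  exact localEulerFactor_smul _ _ _

/-- The `L`-series `L(E, s)` is an isomorphism invariant (from `LFunction_smul`).
[cite: SilvermanAEC2009, App. C §16 (PDF pp. 390–391)] -/
theorem LSeries_smul : (C • W).LSeries = W.LSeries := by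
  funext s
  simp only [WeierstrassCurve.LSeries, LFunction_smul]

/-- The set of entire continuations of `L(E, s)` is an isomorphism invariant. [folklore] -/
theorem entireContinuations_smul : (C • W).entireContinuations = W.entireContinuations := by
  simp only [entireContinuations, LSeries_smul]

/-- Existence of an entire continuation of `L(E, s)` is an isomorphism invariant. [folklore] -/
theorem hasEntireLFunction_smul_iff : (C • W).HasEntireLFunction ↔ W.HasEntireLFunction := by
  simp only [HasEntireLFunction, entireContinuations_smul]

/-- The entire `L`-function `L(E, s)` (`WeierstrassCurve.entireLFunction`, including its junk
branch) is an isomorphism invariant. [folklore] -/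
theorem entireLFunction_smul : (C • W).entireLFunction = W.entireLFunction := by
  unfold entireLFunction
  rw [entireContinuations_smul, LSeries_smul]

/-- The analytic rank `ord_{s=1} L(E, s)` is an isomorphism invariant.
[cite: SilvermanAEC2009, App. C §16 (PDF pp. 390–391)] -/
theorem analyticRank_smul : (C • W).analyticRank = W.analyticRank := by
  simp only [analyticRank, entireLFunction_smul]

/-- The leading Taylor coefficient `L^{(r)}(E, 1)/r!` is an isomorphism invariant.
[cite: SilvermanAEC2009, App. C §16 (PDF pp. 390–391)] -/
theorem leadingLCoeff_smul : (C • W).leadingLCoeff = W.leadingLCoeff := by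
  simp only [leadingLCoeff, analyticRank_smul, entireLFunction_smul]

/-- The (raw) completed `L`-function `N^{s/2} (2π)^{-s} Γ(s) L(E, s)` of a fixed level `N` is an
isomorphism invariant. [cite: SilvermanAEC2009, App. C §16 (PDF pp. 390–391)] -/
theorem completedLFunction_smul (N : ℕ) :
    completedLFunction N (C • W) = completedLFunction N W := by
  funext s
  simp only [completedLFunction, entireLFunction_smul]

end NumberField

end WeierstrassCurve
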